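import Summits.QuantumAdvantage.QuantumAdvantage.Theorems.SymplecticPurityDefs

/-!
# Route `SymplecticPurity`, crux `DeqThesis` (stmt-QuantumAdvantage-0242), line `Sketch` —
# route-posited objects: the TWO-GOLD-MAP witness family `goldFamily`

D-0016 `<Route>Defs`-type file (definitions only, plus the two bookkeeping lemmas needed to *type*
the circuit). It extends `SymplecticPurityDefs.lean` (the scratch-free cube family `cubeFamily` of
item `NoFreeFrame`) by a second value register:

* on input length `n` the family has `n + n` ancillas; after a Hadamard on every input wire it runs
  the compiled reversible program `goldOpsA n = cubeOpsA n ++ pentOpsA n`, which XORs the power-basis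
  coordinates of `y³ = y·y²` into the ancilla wires `n … 2n-1` (this is `cubeOpsA n` verbatim) and
  those of `y⁵ = y·y⁴` into the ancilla wires `2n … 3n-1` (`pentOpsA n`: one `CNOT` per term
  `y_i X^{5i}`, one Toffoli per term `y_i y_j X^{i+4j}`, `i ≠ j`, exponents reduced by `cubeExps`),
  all computed in `𝔽₂[X]/(X^{2h} + X^h + 1)`, `h = n/2` (a field for `n = 2·3^k`);
* so on the input `0ⁿ` its final state is the normalised graph state
  `2^{-n/2} Σ_y |y⟩|y³⟩|y⁵⟩` of the pair of Gold maps `(y³, y⁵)` (proved in the sequel files).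

Why a second Gold map (lead of line `Sketch`, 2026-08-16): against a locally rotated Pauli string
`A ⊗ B¹ ⊗ B²` the pairing `x' = x ⊕ d` gives `|A(x,x⊕d)| = w(d)` with `Σ_d w(d)² = 1`, and for
`d ≠ 0` the two value differences `D_d(x³) = dx² + d²x + d³`, `D_d(x⁵) = dx⁴ + d⁴x + d⁵` are affine in
`x` with fibres `≤ 2` and `≤ 4`; Cauchy–Schwarz between the two value registers then bounds the
off-diagonal part by `2√2 · Σ_d w(d) ≤ 2√2 · 2^{n/2}` for ARBITRARY complex tilts, and the diagonal is
a Gold-type Walsh sum `≤ 4·2^{n/2}`: the state is `7·2^{-n/2}`-flat against every LU-rotated Pauli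
string, with no "doubly-balanced core" left (for the single cube map the same estimate is only `O(1)`).

References: the route file `Theses/SymplecticPurity.lean`; `SymplecticPurityDefs.lean` (cube family);
R. Gold, IEEE Trans. Inform. Theory 14 (1968) (exponents `2ⁱ + 1`); Nielsen–Chuang §4.3.
-/

noncomputable section

set_option linter.dupNamespace false -- D-0017: single-problem summit ⇒ `QuantumAdvantage.QuantumAdvantage` by design

namespace Summit.QuantumAdvantage.QuantumAdvantage.Theorems.SymplecticPurity

open Literature.Computability.QuantumComplexity Literature.Computability.Cryptography

/-! ### The fifth-power program (second value register, wires `2n … 3n-1`) -/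

/-- The linear part of the fifth-power program on input length `n` (`h = n / 2`): one `CNOT` from
input wire `i` onto ancilla wire `n + n + l` for every `l ∈ cubeExps h (5i)` (the terms `y_i X^{5i}`
of `y · y⁴`). -/
def pentLinOps (n : ℕ) : List (ClOp ℕ) :=
  (List.range n).flatMap fun i => (cubeExps (n / 2) (5 * i)).map fun l => ClOp.cnot i (n + n + l)

/-- The quadratic part of the fifth-power program: one Toffoli with controls `i ≠ j` onto ancilla
wire `n + n + l` for every `l ∈ cubeExps h (i + 4j)` (the terms `y_i y_j X^{i + 4j}` of `y · y⁴`). -/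
def pentQuadOps (n : ℕ) : List (ClOp ℕ) :=
  (List.range n).flatMap fun i => (List.range n).flatMap fun j =>
    if i = j then [] else (cubeExps (n / 2) (i + 4 * j)).map fun l => ClOp.toffoli i j (n + n + l)

/-- The fifth-power program on `ℕ`-indexed wires: input register `0 … n-1`, second value register
`2n … 3n-1`. -/
def pentOpsA (n : ℕ) : List (ClOp ℕ) := pentLinOps n ++ pentQuadOps n

/-- The two-Gold-map program: the cube program (`cubeOpsA n`, value register `n … 2n-1`) followed
by the fifth-power program (`pentOpsA n`, value register `2n … 3n-1`). -/
def goldOpsA (n : ℕ) : List (ClOp ℕ) := cubeOpsA n ++ pentOpsA n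

/-- All wires of the fifth-power program are `< n + (n + n)`. -/
theorem pentOpsA_wires {n : ℕ} : ∀ op ∈ pentOpsA n, ∀ i ∈ RevSim.wiresOf op, i < n + (n + n) := by
  intro op hop i hi
  simp only [pentOpsA, pentLinOps, pentQuadOps, List.mem_append, List.mem_flatMap, List.mem_map,
    List.mem_range] at hop
  rcases hop with ⟨a, ha, l, hl, rfl⟩ | ⟨a, ha, b, hb, hop⟩
  · have := lt_of_mem_cubeExps hl
    simp only [RevSim.mem_wiresOf, ClOp.target, ClOp.controls, List.mem_singleton] at hi
    omega
  · split_ifs at hop with hab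
    · simp at hop
    · rw [List.mem_map] at hop
      obtain ⟨l, hl, rfl⟩ := hop
      have := lt_of_mem_cubeExps hl
      simp only [RevSim.mem_wiresOf, ClOp.target, ClOp.controls, List.mem_cons,
        List.not_mem_nil, or_false] at hi
      omega

/-- All wires of the two-Gold-map program are `< n + (n + n)`. -/
theorem goldOpsA_wires {n : ℕ} : ∀ op ∈ goldOpsA n, ∀ i ∈ RevSim.wiresOf op, i < n + (n + n) := by
  intro op hop i hi
  rcases List.mem_append.1 hop with h | h
  · have := cubeOpsA_wires op h i hi; omega
  · exact pentOpsA_wires op h i hi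

/-- The fifth-power program is well formed (each gate acts on pairwise distinct wires). -/
theorem pentOpsA_wf {n : ℕ} : ∀ op ∈ pentOpsA n, op.WF := by
  intro op hop
  simp only [pentOpsA, pentLinOps, pentQuadOps, List.mem_append, List.mem_flatMap, List.mem_map,
    List.mem_range] at hop
  rcases hop with ⟨a, ha, l, -, rfl⟩ | ⟨a, ha, b, hb, hop⟩
  · show a ≠ n + n + l; omega
  · split_ifs at hop with hab
    · simp at hop
    · rw [List.mem_map] at hop
      obtain ⟨l, -, rfl⟩ := hop
      show a ≠ b ∧ a ≠ n + n + l ∧ b ≠ n + n + l; omega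

/-- The two-Gold-map program is well formed. -/
theorem goldOpsA_wf {n : ℕ} : ∀ op ∈ goldOpsA n, op.WF := by
  intro op hop
  rcases List.mem_append.1 hop with h | h
  · exact cubeOpsA_wf op h
  · exact pentOpsA_wf op h

/-- The two-Gold-map program transported to `Fin (n + (n + n))`-indexed wires (reduction
mod `n + (n + n)`, the identity on its wires). -/
def goldOpsFin (n : ℕ) (hn : 0 < n + (n + n)) : List (ClOp (Fin (n + (n + n)))) :=
  (goldOpsA n).map (ClOp.map (RevSim.finOf (n + (n + n)) hn))

/-- The transported program is well formed. -/
theorem goldOpsFin_wf (n : ℕ) (hn : 0 < n + (n + n)) : ∀ op ∈ goldOpsFin n hn, op.WF := by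
  intro op hop
  obtain ⟨op', hop', rfl⟩ := List.mem_map.1 hop
  exact RevSim.wf_map_finOf hn (goldOpsA_wires op' hop') (goldOpsA_wf op' hop')

/-- The gates of the two-Gold-map witness circuit on input length `n`: a Hadamard on each input
wire, then the compiled program (empty for `n = 0`). -/
def goldGates (n : ℕ) : List (QGate cliffordT (n + (n + n))) :=
  if hn : 0 < n + (n + n) then
    (List.finRange n).map (fun i => hOn (Fin.castAdd (n + n) i)) ++
      revCompile (toRevList (goldOpsFin n hn) (goldOpsFin_wf n hn))
  else []

/-- The two-Gold-map witness circuit on input length `n` (`n` input wires, `n + n` ancillas). -/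
def goldCirc (n : ℕ) : QCircuit cliffordT (n + (n + n)) := ⟨goldGates n⟩

/-- The Boolean map computed by the two-Gold-map program into the ancilla registers: bit `j` of the
ancilla block (wire `n + j`, `j < n + n`) after running `goldOpsA n` on `|y⟩|0^{2n}⟩` (for `n = 2·3^k`:
`j = l < n` ↦ coordinate `l` of `y³`, `j = n + l` ↦ coordinate `l` of `y⁵`, proved in the sequel). -/
def goldMap (n : ℕ) (y : Fin n → Bool) : Fin (n + n) → Bool :=
  fun j => clEval (goldOpsA n) (RevSim.liftW (padInput y (n + n))) (n + j)

/-- **The two-Gold-map witness family of line `Sketch`**: `n + n` ancillas on inputs of length `n`;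
on the input `0ⁿ` its final state is the normalised graph state `2^{-n/2} Σ_y |y⟩|y³⟩|y⁵⟩` of the Gold
maps of `𝔽₂[X]/(X^{2h} + X^h + 1)`, `h = n/2` — a field for `n = 2·3^k`. -/
def goldFamily : QCircuitFamily cliffordT :=
  ⟨fun n => n + n, goldCirc⟩

/-- Registered sub-goal `stub_goldDefs` of line `Sketch` (crux `DeqThesis`): the two-Gold-map
witness family carries `n + n` ancillas on inputs of length `n` (definitional; this is the hook
under which the route-posited objects of this file are filed on the crux item). -/
theorem stub_goldDefs : goldFamily.ancillas = fun n => n + n := rfl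

end Summit.QuantumAdvantage.QuantumAdvantage.Theorems.SymplecticPurity
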